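/-
Copyright: the b2b-balaban T⁴-continuum CRUX team, row NE7b OWNER lineage `t4-ne7b-p1` (gen 136). Project licence.
-/
import Summits.QuantumFields.BalabanUV.T4Continuum.Spine.NE7b.SupEffectiveActionDerivative

/-!
# THE EFFECTIVE ACTION OF A BLOCK-LOCAL INPUT IS DIFFERENTIABLE, WITH DERIVATIVE THE TILTED MEAN OF THE INPUT'S DERIVATIVE — (313)'s
# BLOCK TWIN, (β1)'s THIRD BRICK: for ANY `C¹` potential `U : ℝ^ι → ℝ` (derivative `U′`, continuous) with the two LETTERS that replace
# the single-site ones — stability on the cells `−κ₀Σ_Yφ² ≤ U(φ)` and the gradient letter `‖U′(φ)‖ ≤ κ₁(a + Σ_Yφ²)` — over a Gaussian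
# `N(0,Γ)`, `Γ ⪯ γ_op·1`, under the regulator margin `(2κ₀(1+τ)+4δ)γ_op ≤ θ < 1`, at EVERY `ψ₀`:
#   `HasFDerivAt (ψ ↦ −log∫e^{−U(ω+ψ)}dN(0,Γ)) (Z(ψ₀)⁻¹ • ∫e^{−U(ω+ψ₀)} • U′(ω+ψ₀) dN(0,Γ)) ψ₀`
# — (28)'s dominated differentiation with (313)'s domination re-run on the two block letters; together with (397) (upper) and (398)
# (lower, given this derivative) the TWO-SIDED SECOND-ORDER CLASS PASSES THROUGH THE STEP FOR BLOCK-LOCAL INPUTS (row NE7b, node U5c;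
# (28)∕(288)∕(313) BY NAME; [folklore])

Cell `pub-balaban`, sub-cell `t4`, spine estimate NE7b (`T4WeightBudget.RelWeightBound`; the cell's OWN estimate — NOT PRINTED in
[Bałaban 1983–89], NOT PROVED).  Crux-route work under `Spine/NE7b/` by the row OWNER (`t4-ne7b-p1` gen 136, file (399)) under FREEZE
(0)'s crux-prover clause, on this gen's SCOPING-d8 (β1); NOTHING of Bałaban's is named as a Lean object, valued or asserted; no
`T4Continuum/Support` leaf typed; no `def`, no notation; zero `sorry`.  Imports (BY NAME): the OWNER's (313) `…SupEffectiveActionDerivative`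
(`sum_sq_ball_le`, `integrable_domination`, `mul_opBound_le_of_le`) and through it (28) `LogConcaveMarginalDeriv`
(`hasFDerivAt_neg_log_fibreIntegral`), (292) (`sum_add_sq_le`), (288) (`integrable_exp_half_sq_on`).

WHAT IS PROVED ([folklore]; `Y` a site set, `Z(ψ) = ∫e^{−U(ω+ψ)}dN(0,Γ)`):
* §1 `neg_block_le` (`−U(ω+ψ) ≤ κ₀(1+τ)Σ_Yω² + κ₀(1+τ⁻¹)Σ_Yψ²`), `integrable_exp_neg_block`, **`block_domination`** (on `‖ψ−ψ₀‖ ≤ 1`: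
  `e^{−U(ω+ψ)}‖U′(ω+ψ)‖ ≤ κ₁e^{κ₀(1+τ⁻¹)M}(a + 2M + δ⁻¹)e^{½(2κ₀(1+τ)+4δ)Σ_Yω²}`, `M = 2Σ_Yψ₀² + 2`);
* §2 THE END **`hasFDerivAt_block_neg_log`**, `integrable_weighted_blockDeriv`, **`fderiv_block_neg_log_apply`** (the derivative applied to
  `δ` is `Z⁻¹∫e^{−U(ω+ψ₀)}U′(ω+ψ₀)[δ]` — the tilted mean of (397)); §3 toy.

HONEST (what this is NOT).  First derivative only (the Hessian ∕ covariance formula and the third-order letters for block inputs are the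
successor's (319)∕(337b) twins); the letters `κ₀, κ₁, a` are hypotheses on `U`; scalar skeleton ((A3), NC-NE7b-α UNRULED); nothing of Bałaban's
asserted.  BY-NAME EFFECT ON THE WALL: NONE.  NE7b NOT PRINTED ∕ NOT PROVED; spine PROVED 0∕9; rung (B)+1 — the programme's measures remain
FINITE-torus statements; NOT the mass gap, NOT Clay.  HONEST DEPENDENCY: continuum YM on T⁴ ⇐ BetaPertH ∧ nine spine estimates (0∕9 proved);
BetaPertH ⇐ (D1) ∧ (D4) ∧ CAP+tail; G-an2-4 gates asym, D1 and NE2∕3∕4.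
-/

set_option autoImplicit false

noncomputable section

namespace Summit.QuantumFields.BalabanUV.T4Continuum.NE7b.SupBlockEffectiveActionDerivative

open MeasureTheory ProbabilityTheory Finset Real Metric
open scoped BigOperators Topology
open SupEffectiveActionDerivative (sum_sq_ball_le integrable_domination mul_opBound_le_of_le)
open SupRegulatedActivityShift (sum_add_sq_le)
open SupGaussianRegulator (integrable_exp_half_sq_on)
open LogConcaveMarginalDeriv (hasFDerivAt_neg_log_fibreIntegral)

variable {ι : Type} [Fintype ι] [DecidableEq ι]

/-! ## §1. The two block letters and the domination -/

omit [Fintype ι] [DecidableEq ι] in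
/-- **Stability + Young**: `−κ₀Σ_Yφ² ≤ U(φ)` ⟹ `−U(ω+ψ) ≤ κ₀(1+τ)Σ_Yω² + κ₀(1+τ⁻¹)Σ_Yψ²`. [folklore] -/
theorem neg_block_le (Y : Finset ι) {U : EuclideanSpace ℝ ι → ℝ} {κ₀ τ : ℝ} (hκ₀ : 0 ≤ κ₀) (hτ : 0 < τ)
    (hstab : ∀ φ : EuclideanSpace ℝ ι, -(κ₀ * ∑ x ∈ Y, φ x ^ 2) ≤ U φ) (ω ψ : EuclideanSpace ℝ ι) :
    -U (ω + ψ) ≤ κ₀ * (1 + τ) * ∑ x ∈ Y, ω x ^ 2 + κ₀ * (1 + τ⁻¹) * ∑ x ∈ Y, ψ x ^ 2 := by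
  have h1 := hstab (ω + ψ)
  have h2 := mul_le_mul_of_nonneg_left (sum_add_sq_le Y (fun x => ω x) (fun x => ψ x) hτ) hκ₀
  have e : ∑ x ∈ Y, (ω + ψ) x ^ 2 = ∑ x ∈ Y, (ω x + ψ x) ^ 2 := sum_congr rfl fun x _ => by simp
  rw [e] at h1
  linarith

/-- **`e^{−U(ω+ψ)}` is integrable under `N(0,Γ)`** (`U` measurable, stability, `2κ₀(1+τ)γ_op ≤ θ < 1`). [folklore] -/
theorem integrable_exp_neg_block {Γ : Matrix ι ι ℝ} {γop : ℝ} (hΓ : Γ.PosSemidef) (hΓop : (γop • (1 : Matrix ι ι ℝ) - Γ).PosSemidef)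
    (Y : Finset ι) {U : EuclideanSpace ℝ ι → ℝ} (hUm : Measurable U) {κ₀ τ θ : ℝ} (hκ₀ : 0 ≤ κ₀) (hτ : 0 < τ) (hθ1 : θ < 1)
    (hκθ : 2 * κ₀ * (1 + τ) * γop ≤ θ) (hstab : ∀ φ : EuclideanSpace ℝ ι, -(κ₀ * ∑ x ∈ Y, φ x ^ 2) ≤ U φ) (ψ : EuclideanSpace ℝ ι) :
    Integrable (fun ω : EuclideanSpace ℝ ι => exp (-U (ω + ψ))) (multivariateGaussian 0 Γ) := by
  have hκ : 0 ≤ 2 * κ₀ * (1 + τ) := by positivity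
  have hint := (integrable_exp_half_sq_on hΓ hΓop hκ hθ1 hκθ Y).const_mul (exp (κ₀ * (1 + τ⁻¹) * ∑ x ∈ Y, ψ x ^ 2))
  have hmeas : Measurable fun ω : EuclideanSpace ℝ ι => exp (-U (ω + ψ)) :=
    measurable_exp.comp (hUm.comp (measurable_id.add_const ψ)).neg
  refine hint.mono' hmeas.aestronglyMeasurable (ae_of_all _ fun ω => ?_)
  rw [Real.norm_eq_abs, abs_of_pos (exp_pos _), ← exp_add]
  refine exp_le_exp.2 ?_
  have h := neg_block_le Y hκ₀ hτ hstab ω ψ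
  have e : 2 * κ₀ * (1 + τ) * (∑ x ∈ Y, ω x ^ 2) / 2 = κ₀ * (1 + τ) * ∑ x ∈ Y, ω x ^ 2 := by ring
  rw [e]; linarith

omit [DecidableEq ι] in
/-- **THE BLOCK DOMINATION**: stability (`κ₀ ≥ 0`), the gradient letter `‖U′(φ)‖ ≤ κ₁(a + Σ_Yφ²)` (`κ₁, a ≥ 0`), `0 < τ`, `0 < δ`; for
`‖ψ − ψ₀‖ ≤ 1` and every `ω`, with `M = 2Σ_Yψ₀² + 2`:
`e^{−U(ω+ψ)}·‖U′(ω+ψ)‖ ≤ κ₁e^{κ₀(1+τ⁻¹)M}(a + 2M + δ⁻¹)·e^{½(2κ₀(1+τ)+4δ)Σ_Yω²}`. [folklore] -/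
theorem block_domination (Y : Finset ι) {U : EuclideanSpace ℝ ι → ℝ} {U' : EuclideanSpace ℝ ι → EuclideanSpace ℝ ι →L[ℝ] ℝ}
    {κ₀ κ₁ a τ δ : ℝ} (hκ₀ : 0 ≤ κ₀) (hκ₁ : 0 ≤ κ₁) (ha : 0 ≤ a) (hτ : 0 < τ) (hδ : 0 < δ)
    (hstab : ∀ φ : EuclideanSpace ℝ ι, -(κ₀ * ∑ x ∈ Y, φ x ^ 2) ≤ U φ)
    (hU'b : ∀ φ : EuclideanSpace ℝ ι, ‖U' φ‖ ≤ κ₁ * (a + ∑ x ∈ Y, φ x ^ 2)) (ψ₀ ψ : EuclideanSpace ℝ ι) (hψ : ‖ψ - ψ₀‖ ≤ 1)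
    (ω : EuclideanSpace ℝ ι) :
    exp (-U (ω + ψ)) * ‖U' (ω + ψ)‖ ≤
      κ₁ * exp (κ₀ * (1 + τ⁻¹) * (2 * ∑ x ∈ Y, ψ₀ x ^ 2 + 2)) * (a + 2 * (2 * ∑ x ∈ Y, ψ₀ x ^ 2 + 2) + δ⁻¹) *
        exp ((2 * κ₀ * (1 + τ) + 4 * δ) * (∑ x ∈ Y, ω x ^ 2) / 2) := by
  set M : ℝ := 2 * ∑ x ∈ Y, ψ₀ x ^ 2 + 2 with hM
  set Sω : ℝ := ∑ x ∈ Y, ω x ^ 2 with hSω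
  have hSω0 : 0 ≤ Sω := sum_nonneg fun x _ => sq_nonneg _
  have hM0 : 0 ≤ M := by rw [hM]; positivity
  have hψM : ∑ x ∈ Y, ψ x ^ 2 ≤ M := sum_sq_ball_le Y hψ
  -- the exponent: stability + Young
  have hV : -U (ω + ψ) ≤ κ₀ * (1 + τ) * Sω + κ₀ * (1 + τ⁻¹) * M := by
    have h := neg_block_le Y hκ₀ hτ hstab ω ψ
    have h2 : κ₀ * (1 + τ⁻¹) * ∑ x ∈ Y, ψ x ^ 2 ≤ κ₀ * (1 + τ⁻¹) * M := mul_le_mul_of_nonneg_left hψM (by positivity)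
    linarith
  -- the derivative: the gradient letter and `Σ(ω+ψ)² ≤ 2Σω² + 2Σψ²`
  have hsum : ∑ x ∈ Y, (ω + ψ) x ^ 2 ≤ 2 * Sω + 2 * M := by
    have h := sum_add_sq_le Y (fun x => ω x) (fun x => ψ x) one_pos
    have e : ∑ x ∈ Y, (ω + ψ) x ^ 2 = ∑ x ∈ Y, (ω x + ψ x) ^ 2 := sum_congr rfl fun x _ => by simp
    rw [e]
    norm_num at h
    linarith
  have hD' : ‖U' (ω + ψ)‖ ≤ κ₁ * (a + 2 * M + 2 * Sω) := by
    refine (hU'b (ω + ψ)).trans (mul_le_mul_of_nonneg_left ?_ hκ₁)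
    linarith
  -- `2Σω² ≤ δ⁻¹e^{2δΣω²}` and the polynomial prefactor under one exponential
  have hpoly : a + 2 * M + 2 * Sω ≤ (a + 2 * M + δ⁻¹) * exp (2 * δ * Sω) := by
    have h1 : 1 ≤ exp (2 * δ * Sω) := one_le_exp_iff.2 (by positivity)
    have h2 : 2 * δ * Sω ≤ exp (2 * δ * Sω) := by linarith [add_one_le_exp (2 * δ * Sω)]
    have h3 : 2 * Sω ≤ δ⁻¹ * exp (2 * δ * Sω) := by
      rw [le_inv_mul_iff₀' hδ]
      linarith
    have h4 : a + 2 * M ≤ (a + 2 * M) * exp (2 * δ * Sω) := le_mul_of_one_le_right (by positivity) h1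
    nlinarith
  calc exp (-U (ω + ψ)) * ‖U' (ω + ψ)‖
      ≤ exp (κ₀ * (1 + τ) * Sω + κ₀ * (1 + τ⁻¹) * M) * (κ₁ * ((a + 2 * M + δ⁻¹) * exp (2 * δ * Sω))) :=
        mul_le_mul (exp_le_exp.2 hV) (hD'.trans (mul_le_mul_of_nonneg_left hpoly hκ₁)) (norm_nonneg _) (exp_pos _).le
    _ = κ₁ * exp (κ₀ * (1 + τ⁻¹) * M) * (a + 2 * M + δ⁻¹) * exp ((2 * κ₀ * (1 + τ) + 4 * δ) * Sω / 2) := by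
        have he : exp (κ₀ * (1 + τ) * Sω + κ₀ * (1 + τ⁻¹) * M) * exp (2 * δ * Sω) =
            exp (κ₀ * (1 + τ⁻¹) * M) * exp ((2 * κ₀ * (1 + τ) + 4 * δ) * Sω / 2) := by
          rw [← exp_add, ← exp_add]
          congr 1
          ring
        calc exp (κ₀ * (1 + τ) * Sω + κ₀ * (1 + τ⁻¹) * M) * (κ₁ * ((a + 2 * M + δ⁻¹) * exp (2 * δ * Sω)))
            = κ₁ * (a + 2 * M + δ⁻¹) * (exp (κ₀ * (1 + τ) * Sω + κ₀ * (1 + τ⁻¹) * M) * exp (2 * δ * Sω)) := by ring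
          _ = _ := by rw [he]; ring

/-! ## §2. THE END: the block effective action is differentiable at every external field -/

section TheEnd

variable {Γ : Matrix ι ι ℝ} {γop : ℝ} {U : EuclideanSpace ℝ ι → ℝ} {U' : EuclideanSpace ℝ ι → EuclideanSpace ℝ ι →L[ℝ] ℝ}
  {κ₀ κ₁ a τ δ θ : ℝ}

/-- **THE END — THE EFFECTIVE ACTION OF A BLOCK-LOCAL INPUT IS DIFFERENTIABLE, WITH DERIVATIVE THE TILTED MEAN OF `U′`.**  `Γ ⪰ 0`,
`Γ ⪯ γ_op·1`; `U` everywhere differentiable with `HasFDerivAt U (U′ φ) φ`, `U′` continuous; the two block letters on the site set `Y`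
(stability `κ₀ ≥ 0`, gradient `κ₁, a ≥ 0`); `0 < τ`, `0 < δ`, `0 < θ < 1`, `(2κ₀(1+τ)+4δ)γ_op ≤ θ` ⟹ at EVERY `ψ₀`,
`HasFDerivAt (ψ ↦ −log∫e^{−U(ω+ψ)}dN(0,Γ)) (Z(ψ₀)⁻¹ • ∫e^{−U(ω+ψ₀)} • U′(ω+ψ₀) dN(0,Γ)) ψ₀`. [folklore] -/
theorem hasFDerivAt_block_neg_log (hΓ : Γ.PosSemidef) (hΓop : (γop • (1 : Matrix ι ι ℝ) - Γ).PosSemidef) (Y : Finset ι)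
    (hUd : ∀ φ : EuclideanSpace ℝ ι, HasFDerivAt U (U' φ) φ) (hU'c : Continuous U')
    (hκ₀ : 0 ≤ κ₀) (hκ₁ : 0 ≤ κ₁) (ha : 0 ≤ a) (hτ : 0 < τ) (hδ : 0 < δ) (hθ0 : 0 < θ) (hθ1 : θ < 1)
    (hκθ : (2 * κ₀ * (1 + τ) + 4 * δ) * γop ≤ θ) (hstab : ∀ φ : EuclideanSpace ℝ ι, -(κ₀ * ∑ x ∈ Y, φ x ^ 2) ≤ U φ)
    (hU'b : ∀ φ : EuclideanSpace ℝ ι, ‖U' φ‖ ≤ κ₁ * (a + ∑ x ∈ Y, φ x ^ 2)) (ψ₀ : EuclideanSpace ℝ ι) :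
    HasFDerivAt (fun ψ : EuclideanSpace ℝ ι => -log (∫ ω : EuclideanSpace ℝ ι, exp (-U (ω + ψ)) ∂(multivariateGaussian 0 Γ)))
      ((∫ ω : EuclideanSpace ℝ ι, exp (-U (ω + ψ₀)) ∂(multivariateGaussian 0 Γ))⁻¹ •
        ∫ ω : EuclideanSpace ℝ ι, exp (-U (ω + ψ₀)) • U' (ω + ψ₀) ∂(multivariateGaussian 0 Γ)) ψ₀ := by
  have hUc : Continuous U := continuous_iff_continuousAt.2 fun φ => (hUd φ).continuousAt
  have hUm : Measurable U := hUc.measurable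
  have hκθ₀ : 2 * κ₀ * (1 + τ) * γop ≤ θ := mul_opBound_le_of_le (by positivity) (by linarith) hθ0.le hκθ
  have hI := integrable_exp_neg_block hΓ hΓop Y hUm hκ₀ hτ hθ1 hκθ₀ hstab ψ₀
  have hZ : 0 < ∫ ω : EuclideanSpace ℝ ι, exp (-U (ω + ψ₀)) ∂(multivariateGaussian 0 Γ) := integral_exp_pos hI
  exact hasFDerivAt_neg_log_fibreIntegral (μ := multivariateGaussian 0 Γ)
    (V := fun q : EuclideanSpace ℝ ι × EuclideanSpace ℝ ι => U (q.2 + q.1))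
    (Vx := fun q : EuclideanSpace ℝ ι × EuclideanSpace ℝ ι => U' (q.2 + q.1))
    (x₀ := ψ₀) (U := closedBall ψ₀ 1) (closedBall_mem_nhds ψ₀ one_pos)
    (fun ψ _ => (hUm.comp (measurable_id.add_const ψ)).aestronglyMeasurable) hI
    ((hU'c.comp (continuous_id.add continuous_const)).aestronglyMeasurable)
    (fun ψ _ ω => by
      have hlin : HasFDerivAt (fun ψ' : EuclideanSpace ℝ ι => ω + ψ') (ContinuousLinearMap.id ℝ (EuclideanSpace ℝ ι)) ψ :=
        (hasFDerivAt_id ψ).const_add ω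
      have h := (hUd (ω + ψ)).comp ψ hlin
      rw [ContinuousLinearMap.comp_id] at h
      exact h)
    (integrable_domination hΓ hΓop Y hκ₀ hτ hδ hθ1 hκθ
      (κ₁ * exp (κ₀ * (1 + τ⁻¹) * (2 * ∑ x ∈ Y, ψ₀ x ^ 2 + 2)) * (a + 2 * (2 * ∑ x ∈ Y, ψ₀ x ^ 2 + 2) + δ⁻¹)))
    (fun ψ hψ ω => by
      rw [mem_closedBall, dist_eq_norm] at hψ
      exact block_domination Y hκ₀ hκ₁ ha hτ hδ hstab hU'b ψ₀ ψ hψ ω) hZ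

/-- **The weighted derivative is Bochner integrable** (dominated at the centre of the ball). [folklore] -/
theorem integrable_weighted_blockDeriv (hΓ : Γ.PosSemidef) (hΓop : (γop • (1 : Matrix ι ι ℝ) - Γ).PosSemidef) (Y : Finset ι)
    (hUd : ∀ φ : EuclideanSpace ℝ ι, HasFDerivAt U (U' φ) φ) (hU'c : Continuous U')
    (hκ₀ : 0 ≤ κ₀) (hκ₁ : 0 ≤ κ₁) (ha : 0 ≤ a) (hτ : 0 < τ) (hδ : 0 < δ) (hθ1 : θ < 1)
    (hκθ : (2 * κ₀ * (1 + τ) + 4 * δ) * γop ≤ θ) (hstab : ∀ φ : EuclideanSpace ℝ ι, -(κ₀ * ∑ x ∈ Y, φ x ^ 2) ≤ U φ)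
    (hU'b : ∀ φ : EuclideanSpace ℝ ι, ‖U' φ‖ ≤ κ₁ * (a + ∑ x ∈ Y, φ x ^ 2)) (ψ₀ : EuclideanSpace ℝ ι) :
    Integrable (fun ω : EuclideanSpace ℝ ι => exp (-U (ω + ψ₀)) • U' (ω + ψ₀)) (multivariateGaussian 0 Γ) := by
  have hUc : Continuous U := continuous_iff_continuousAt.2 fun φ => (hUd φ).continuousAt
  have hmeas : AEStronglyMeasurable (fun ω : EuclideanSpace ℝ ι => exp (-U (ω + ψ₀)) • U' (ω + ψ₀)) (multivariateGaussian 0 Γ) :=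
    ((continuous_exp.comp (hUc.comp (continuous_id.add continuous_const)).neg).aestronglyMeasurable).smul
      ((hU'c.comp (continuous_id.add continuous_const)).aestronglyMeasurable)
  refine (integrable_domination hΓ hΓop Y hκ₀ hτ hδ hθ1 hκθ
    (κ₁ * exp (κ₀ * (1 + τ⁻¹) * (2 * ∑ x ∈ Y, ψ₀ x ^ 2 + 2)) * (a + 2 * (2 * ∑ x ∈ Y, ψ₀ x ^ 2 + 2) + δ⁻¹))).mono' hmeas
    (ae_of_all _ fun ω => ?_)
  rw [norm_smul, Real.norm_eq_abs, abs_of_pos (exp_pos _)]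
  exact block_domination Y hκ₀ hκ₁ ha hτ hδ hstab hU'b ψ₀ ψ₀ (by rw [sub_self, norm_zero]; exact zero_le_one) ω

/-- **THE DERIVATIVE IN A DIRECTION `δ` IS THE TILTED MEAN OF `U′(ω+ψ₀)[δ]`** — the middle term of (397)'s upper letter and the `L` of
(398)'s lower letter. [folklore] -/
theorem fderiv_block_neg_log_apply (hΓ : Γ.PosSemidef) (hΓop : (γop • (1 : Matrix ι ι ℝ) - Γ).PosSemidef) (Y : Finset ι)
    (hUd : ∀ φ : EuclideanSpace ℝ ι, HasFDerivAt U (U' φ) φ) (hU'c : Continuous U')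
    (hκ₀ : 0 ≤ κ₀) (hκ₁ : 0 ≤ κ₁) (ha : 0 ≤ a) (hτ : 0 < τ) (hδ : 0 < δ) (hθ1 : θ < 1)
    (hκθ : (2 * κ₀ * (1 + τ) + 4 * δ) * γop ≤ θ) (hstab : ∀ φ : EuclideanSpace ℝ ι, -(κ₀ * ∑ x ∈ Y, φ x ^ 2) ≤ U φ)
    (hU'b : ∀ φ : EuclideanSpace ℝ ι, ‖U' φ‖ ≤ κ₁ * (a + ∑ x ∈ Y, φ x ^ 2)) (ψ₀ v : EuclideanSpace ℝ ι) :
    ((∫ ω : EuclideanSpace ℝ ι, exp (-U (ω + ψ₀)) ∂(multivariateGaussian 0 Γ))⁻¹ •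
        ∫ ω : EuclideanSpace ℝ ι, exp (-U (ω + ψ₀)) • U' (ω + ψ₀) ∂(multivariateGaussian 0 Γ)) v =
      (∫ ω : EuclideanSpace ℝ ι, exp (-U (ω + ψ₀)) ∂(multivariateGaussian 0 Γ))⁻¹ *
        ∫ ω : EuclideanSpace ℝ ι, exp (-U (ω + ψ₀)) * U' (ω + ψ₀) v ∂(multivariateGaussian 0 Γ) := by
  rw [FunLike.coe_smul, Pi.smul_apply, ContinuousLinearMap.integral_apply
    (integrable_weighted_blockDeriv hΓ hΓop Y hUd hU'c hκ₀ hκ₁ ha hτ hδ hθ1 hκθ hstab hU'b ψ₀), smul_eq_mul]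
  congr 1

end TheEnd

/-! ## §3. Toy -/

/-- Toy (§1): the zero potential is stable with `κ₀ = 0`, and `−0 ≤ 0`. -/
example (Y : Finset ι) (ω ψ : EuclideanSpace ℝ ι) :
    -(fun _ : EuclideanSpace ℝ ι => (0 : ℝ)) (ω + ψ) ≤ 0 * (1 + 1) * ∑ x ∈ Y, ω x ^ 2 + 0 * (1 + (1 : ℝ)⁻¹) * ∑ x ∈ Y, ψ x ^ 2 :=
  neg_block_le (U := fun _ : EuclideanSpace ℝ ι => (0 : ℝ)) Y le_rfl one_pos (fun φ => by simp) ω ψ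

end Summit.QuantumFields.BalabanUV.T4Continuum.NE7b.SupBlockEffectiveActionDerivative
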